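import Summits.QuantumFields.YangMills.Theorems.UnitScaleTiltProp7TrueLinIterRowOfStairGauge
import Summits.QuantumFields.YangMills.Theorems.UnitScaleTiltProp7QTwSColumnBound
import HarnessLib

/-!
# Route `UnitScaleTilt`, crux K1 «MinimiserStabilityRegPr» (stmt-QuantumFields-19200), EX face — K-storey pen (K1b-a) (px12 g16 LOCATE-K137; px13 g15) — ROW brick 3:
# **THE AVERAGING OPERATOR OF RECORD IN SUP NORM AT A PRINTED-REGULAR BACKGROUND** — `‖QTwS U₀ B(ĉ')‖ ≤ e^{κ_∞B_c∕L}·L^{K−n}·‖B‖_∞` and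
# `L·‖QTwS U₀ B(ĉ') − S_{K−n}(ĉ)‖ ≤ L^{K−n}·κ_∞B_c·e^{κ_∞B_c∕L}·‖B‖_∞` (𝔰𝔲(2) fields; `S` the pure nested-stair LINE iterate), i.e. `η·QTwS U₀` is an `ℓ^∞`-contraction sup-close
# (`O(L⁵ε₀)`) to `η·S_{K−n}` on BOUNDED fields — a sup-norm currency for pointwise ∕ kernel consumers of the K-storey

Cell `ym3-torus` (HUMAN RULING D-0037; rung R3 = SU(2) YM₃ on T³ — NOT d = 4, NOT infinite volume, NOT a mass gap, NOT Clay).  Width seat `ym3-torus-px13` (gen 15).  THEOREMS ONLY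
(0 `def`, 0 `sorry`); `--supports stmt-QuantumFields-19200 --as helper`; count-neutral.  Sibling of ✓`Prop7QTwSColumnBound` ((COL), the `ℓ¹` reading).

THE POINT.  (R3) ✓`QTwS_apply_eq_frameReduced_bondShift` + ROW brick 2 ✓`norm_frameReduced_sub_lineIter_le_of_sup_of_regPr` at `k = K − n`.  The sup rows give
`η·‖error‖_∞ ≤ O(L⁵ε₀)·‖B‖_∞` — K-free — next to the `ℓ²` rows (R1)∕(R2) (which carry (K1b-a)'s row (a) through (L5c) ✓`Prop7QTwSLocalGaugeComparison`) and the `ℓ¹` column rows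
(COL) ✓`Prop7QTwSColumnBound`; pointwise ∕ kernel consumers ((K3)∕(K4): «`Q_k† e_y` supported on the tube … pointwise decay») read this currency.

WHAT IS PROVED (ns `…Theorems.Prop7QTwSSupRows`; T³, `SU(2)`, `RegPr F n K ε₀ U₀`, windows `10¹⁰L⁶ε₀ ≤ 1`, `10¹²L³ε₀ ≤ 1`).
* §1 ★★ `norm_QTwS_sub_lineIter_le_of_sup` — for 𝔰𝔲(2)-valued `B` with `‖B b‖ ≤ M`, ANY true-linearisation family `Q` (`hQ0 ∕ hQs`) and the pure LINE iterate `S` (`hS0 ∕ hSs`):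
  `∀ ĉ', L·‖QTwS U₀ B ĉ' − S (K−n) (bondShift ĉ')‖ ≤ L^{K−n}·κ_∞·B_c·exp(κ_∞B_c∕L)·M` and `∀ ĉ', ‖QTwS U₀ B ĉ'‖ ≤ L^{K−n}·exp(κ_∞B_c∕L)·M`,
  `κ_∞ = 159(d+2)L·(2dL^d)`, `B_c = ((d+2)L)²ε₀∕16`.
* §2 `row_exponent_le` (`κ_∞B_c∕L ≤ 1∕100` in the window) · `row_const_le_two` (`exp(κ_∞B_c∕L) ≤ 2`).
HONEST SCOPE.  Bookkeeping over landed rows; nothing of (K1b), the K137 rows, EX or the crux is proved here.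

References: T. Bałaban, CMP **99** (1985) 389–434 [Balaban1985BackgroundPropagators] ((3.13)–(3.15) p.393); CMP **98** (1985) 17–51 [Balaban1985Averaging] (Prop. 2 (53) p.26,
Prop. 3 (124)–(126) p.36); CMP **95** (1984) 17–40 [Balaban1984PropagatorsI] ((1.18)–(1.20) pp.19–20); CMP **102** (1985) 277–309 [Balaban1985Variational] ((2) p.278).
-/

set_option autoImplicit false

noncomputable section

open scoped BigOperators Matrix.Norms.L2Operator Matrix

namespace Summit.QuantumFields.YangMills.Theorems.Prop7QTwSSupRows

open Literature.MathematicalPhysics.QuantumFieldTheory.Balaban1983to89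
open Literature.MathematicalPhysics.QuantumFieldTheory.Balaban1983to89.T3ContinuumYM3Torus
open Finset T4Continuum BlockAveraging AveragingRT ExpMeanLog BlockAveragingEMLLinearised BlockAveragingEMLLinearisedBackground BlockAveragingEMLProp2
open B7Prop1Explicit (expUnit)
open T3LevelShift (bondShift)
open T3PrintedRegularOrbits (sites_eq)
open T3PrintedRegularMinimiser (RegPr)
open T3SectALandauChart (bgUnits)
open Summit.QuantumFields.YangMills.Theorems.Prop8Chart (emlIterU)
open Summit.QuantumFields.YangMills.Theorems.Prop7SymAvgTwSym (QTwS)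
open Summit.QuantumFields.YangMills.Theorems.Prop7CoarseGaugeEqFrameResponseQTwS (exists_stairGauge_family QTwS_apply_eq_frameReduced_bondShift)
open Summit.QuantumFields.YangMills.Theorems.Prop7TrueLinIterRowOfStairGauge (norm_frameReduced_sub_lineIter_le_of_sup_of_regPr)

variable (F : T3Family) {n K : ℕ} (h : n ≤ K)

/-! ## §1 ★★ The sup rows of `QTwS U₀` on 𝔰𝔲(2) fields -/

set_option maxHeartbeats 400000 in
-- HEARTBEAT rule (README): the statement carries the ~25-line `hQs`∕`hSs` binders and instantiates (R3) + ROW brick 2; sibling (COL) §1 measured > 100k; decl-local budget.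
/-- ★★ **`QTwS U₀` IN SUP NORM AT A PRINTED-REGULAR BACKGROUND, AND SUP-CLOSE TO THE PURE LINE ITERATE**: `RegPr F n K ε₀ U₀`, `10¹⁰L⁶ε₀ ≤ 1`, `10¹²L³ε₀ ≤ 1`, `B` 𝔰𝔲(2)-valued with
`‖B b‖ ≤ M`, `Q` any true-linearisation recursion family (`hQ0 ∕ hQs`), `S` the pure LINE iterate (`hS0 ∕ hSs`) ⟹ for every unit-lattice bond `ĉ'`:
`L·‖QTwS U₀ B ĉ' − S (K−n) ĉ‖ ≤ L^{K−n}·κ_∞·B_c·exp(κ_∞B_c∕L)·M` and `‖QTwS U₀ B ĉ'‖ ≤ L^{K−n}·exp(κ_∞B_c∕L)·M` (`ĉ = bondShift ĉ'`).  PROOF: (R3) at the stair gauges of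
✓`exists_stairGauge_family`, then ROW brick 2 §3 at `k = K − n`. [cite: Balaban1985BackgroundPropagators, (3.13)-(3.15) p.393; Balaban1985Averaging, Prop. 2 (53) p.26, Prop. 3 (124)-(126) p.36; Balaban1984PropagatorsI, (1.18)-(1.20) pp.19-20] -/
theorem norm_QTwS_sub_lineIter_le_of_sup {ε₀ : ℝ} (hε₀ : 0 < ε₀) (hε : 10 ^ 10 * (F.L : ℝ) ^ 6 * ε₀ ≤ 1) (hε12 : 10 ^ 12 * (F.L : ℝ) ^ 3 * ε₀ ≤ 1)
    (W : GaugeField (F.P K) 0 (Matrix.specialUnitaryGroup (Fin 2) ℂ)) (hreg : RegPr F n K ε₀ W)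
    (Q : (k : ℕ) → (PBond (F.P K) 0 → Matrix (Fin 2) (Fin 2) ℂ) → PBond (F.P K) k → Matrix (Fin 2) (Fin 2) ℂ) (hQ0 : ∀ Y, Q 0 Y = Y)
    (hQs : ∀ (k : ℕ) (Y : PBond (F.P K) 0 → Matrix (Fin 2) (Fin 2) ℂ) (c : PBond (F.P K) (k + 1)), Q (k + 1) Y c
      = (fderiv ℂ (eml : (Idx (F.P K) → Matrix (Fin 2) (Fin 2) ℂ) → Matrix (Fin 2) (Fin 2) ℂ)
            (fun i => ((loopHol (Averaging.iter (fun i => blockAvg (P := F.P K) (j := i) (expMeanLogSU (n := Fin 2))) k W) c i : Matrix.specialUnitaryGroup (Fin 2) ℂ) : Matrix (Fin 2) (Fin 2) ℂ))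
            (fun i => covWalkSum (Averaging.iter (fun i => blockAvg (P := F.P K) (j := i) (expMeanLogSU (n := Fin 2))) k W) (Q k Y)
                (walk (emb c.src) (loopWord (F.P K).L c.dir (off i.1) i.2.1 i.2.2))
              * ((loopHol (Averaging.iter (fun i => blockAvg (P := F.P K) (j := i) (expMeanLogSU (n := Fin 2))) k W) c i : Matrix.specialUnitaryGroup (Fin 2) ℂ) : Matrix (Fin 2) (Fin 2) ℂ))
            * star ((corr (expMeanLogSU (n := Fin 2)) (Averaging.iter (fun i => blockAvg (P := F.P K) (j := i) (expMeanLogSU (n := Fin 2))) k W) c : Matrix.specialUnitaryGroup (Fin 2) ℂ) : Matrix (Fin 2) (Fin 2) ℂ)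
          + ((corr (expMeanLogSU (n := Fin 2)) (Averaging.iter (fun i => blockAvg (P := F.P K) (j := i) (expMeanLogSU (n := Fin 2))) k W) c : Matrix.specialUnitaryGroup (Fin 2) ℂ) : Matrix (Fin 2) (Fin 2) ℂ)
            * covWalkSum (Averaging.iter (fun i => blockAvg (P := F.P K) (j := i) (expMeanLogSU (n := Fin 2))) k W) (Q k Y)
                (walk (emb c.src) (List.replicate (F.P K).L (c.dir, true)))
            * star ((corr (expMeanLogSU (n := Fin 2)) (Averaging.iter (fun i => blockAvg (P := F.P K) (j := i) (expMeanLogSU (n := Fin 2))) k W) c : Matrix.specialUnitaryGroup (Fin 2) ℂ) : Matrix (Fin 2) (Fin 2) ℂ)))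
    (B : PBond (F.P K) 0 → Matrix (Fin 2) (Fin 2) ℂ) (hsk : ∀ b, star (B b) = -B b) (htr : ∀ b, (B b).trace = 0)
    (S : (k : ℕ) → PBond (F.P K) k → Matrix (Fin 2) (Fin 2) ℂ) (hS0 : ∀ b, S 0 b = B b)
    (hSs : ∀ (k : ℕ) (c : PBond (F.P K) (k + 1)), S (k + 1) c
      = ((Fintype.card (Idx (F.P K)) : ℂ))⁻¹ • ∑ i : Idx (F.P K),
          (((holAt (Averaging.iter (fun i => blockAvg (P := F.P K) (j := i) (expMeanLogSU (n := Fin 2))) k W) (walk (emb c.src) (stairWord i.2.1 (off i.1))) : Matrix.specialUnitaryGroup (Fin 2) ℂ) : Matrix (Fin 2) (Fin 2) ℂ) *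
            covWalkSum (Averaging.iter (fun i => blockAvg (P := F.P K) (j := i) (expMeanLogSU (n := Fin 2))) k W) (S k)
              (walk (walkEnd (emb c.src) (stairWord i.2.1 (off i.1))) (List.replicate (F.P K).L (c.dir, true))) *
          star ((holAt (Averaging.iter (fun i => blockAvg (P := F.P K) (j := i) (expMeanLogSU (n := Fin 2))) k W) (walk (emb c.src) (stairWord i.2.1 (off i.1))) : Matrix.specialUnitaryGroup (Fin 2) ℂ) : Matrix (Fin 2) (Fin 2) ℂ)))
    {M : ℝ} (hM0 : 0 ≤ M) (hM : ∀ b, ‖B b‖ ≤ M) :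
    (∀ c' : PBond (F.P n) 0, ((F.P K).L : ℝ) * ‖QTwS F n K h W B c' - S (K - n) (bondShift (sites_eq F n K h) c')‖
        ≤ ((F.P K).L : ℝ) ^ (K - n) * (159 * ((((F.P K).d + 2) * (F.P K).L : ℕ) : ℝ) * (2 * (F.P K).d * ((F.P K).L : ℝ) ^ (F.P K).d))
          * (((((F.P K).d + 2) * (F.P K).L : ℕ) : ℝ) ^ 2 / 16 * ε₀)
          * Real.exp ((159 * ((((F.P K).d + 2) * (F.P K).L : ℕ) : ℝ) * (2 * (F.P K).d * ((F.P K).L : ℝ) ^ (F.P K).d))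
              / ((F.P K).L : ℝ) * (((((F.P K).d + 2) * (F.P K).L : ℕ) : ℝ) ^ 2 / 16 * ε₀)) * M)
      ∧ ∀ c' : PBond (F.P n) 0, ‖QTwS F n K h W B c'‖
        ≤ ((F.P K).L : ℝ) ^ (K - n) * Real.exp ((159 * ((((F.P K).d + 2) * (F.P K).L : ℕ) : ℝ) * (2 * (F.P K).d * ((F.P K).L : ℝ) ^ (F.P K).d))
              / ((F.P K).L : ℝ) * (((((F.P K).d + 2) * (F.P K).L : ℕ) : ℝ) ^ 2 / 16 * ε₀)) * M := by
  classical
  have hA : ∀ b, B b ∈ skewAdjoint (Matrix (Fin 2) (Fin 2) ℂ) := fun b => by rw [skewAdjoint.mem_iff]; exact hsk b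
  obtain ⟨Λ, hΛ0, hΛs⟩ := exists_stairGauge_family F (K := K) W B
  -- (R3): `QTwS W B c' = G ĉ`, `G` the frame-reduced part in px13's letters
  have hR3 : ∀ c' : PBond (F.P n) 0, QTwS F n K h W B c'
      = ((fderiv ℂ (fun t : PBond (F.P K) 0 → Matrix (Fin 2) (Fin 2) ℂ =>
                (((emlIterU (K - n) (fun b' => expUnit (t b') * bgUnits F K W b') (bondShift (sites_eq F n K h) c') : (Matrix (Fin 2) (Fin 2) ℂ)ˣ) : Matrix (Fin 2) (Fin 2) ℂ))) 0 B
              * star ((Averaging.iter (fun i => blockAvg (P := F.P K) (j := i) (expMeanLogSU (n := Fin 2))) (K - n) W (bondShift (sites_eq F n K h) c') : Matrix.specialUnitaryGroup (Fin 2) ℂ) : Matrix (Fin 2) (Fin 2) ℂ))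
          - (Λ (K - n) (bondShift (sites_eq F n K h) c').src - ((Averaging.iter (fun i => blockAvg (P := F.P K) (j := i) (expMeanLogSU (n := Fin 2))) (K - n) W (bondShift (sites_eq F n K h) c') : Matrix.specialUnitaryGroup (Fin 2) ℂ) : Matrix (Fin 2) (Fin 2) ℂ) * Λ (K - n) (bondShift (sites_eq F n K h) c').tgt * star ((Averaging.iter (fun i => blockAvg (P := F.P K) (j := i) (expMeanLogSU (n := Fin 2))) (K - n) W (bondShift (sites_eq F n K h) c') : Matrix.specialUnitaryGroup (Fin 2) ℂ) : Matrix (Fin 2) (Fin 2) ℂ))) :=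
    fun c' => QTwS_apply_eq_frameReduced_bondShift F h hε₀ hε hε12 W hreg Q hQ0 hQs B hA htr Λ hΛ0 (fun k _ y => hΛs k y) c'
  -- ROW brick 2 §3 at the target level
  obtain ⟨h1, h2⟩ := norm_frameReduced_sub_lineIter_le_of_sup_of_regPr F hε₀ hε hε12 W hreg Q hQ0 hQs B hA htr Λ hΛ0
    (fun k _ y => hΛs k y) S hS0 hSs (k := K - n) le_rfl hM0 hM
  exact ⟨fun c' => by rw [hR3 c']; exact h1 _, fun c' => by rw [hR3 c']; exact h2 _⟩

/-! ## §2 The row constants in the window -/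

/-- **THE ROW EXPONENT IS `≤ 1∕100`** in the EX window: `κ_∞B_c∕L = 159·5L·6L³·25L²ε₀∕(16L) ≤ 7454·L⁵ε₀ ≤ 10⁻⁵`. [cite: Balaban1985Variational, (2) p.278] -/
theorem row_exponent_le {ε₀ : ℝ} (hε₀ : 0 < ε₀) (hε : 10 ^ 10 * (F.L : ℝ) ^ 6 * ε₀ ≤ 1) :
    (159 * ((((F.P K).d + 2) * (F.P K).L : ℕ) : ℝ) * (2 * (F.P K).d * ((F.P K).L : ℝ) ^ (F.P K).d))
        / ((F.P K).L : ℝ) * (((((F.P K).d + 2) * (F.P K).L : ℕ) : ℝ) ^ 2 / 16 * ε₀) ≤ 1 / 100 := by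
  have hd : (F.P K).d = 3 := T3Family.P_d F K
  have hLL : ((F.P K).L : ℝ) = F.L := rfl
  have hL3 : (3 : ℝ) ≤ F.L := by
    have h3 : 3 ≤ F.L := by obtain ⟨a, ha⟩ := F.hL.1; have := F.hL.2; omega
    exact_mod_cast h3
  have hL0 : (0 : ℝ) < F.L := by linarith
  rw [hd]; push_cast; rw [hLL]
  have hL6 : (F.L : ℝ) ^ 5 * ε₀ ≤ (F.L : ℝ) ^ 6 * ε₀ := by
    have : (F.L : ℝ) ^ 5 ≤ (F.L : ℝ) ^ 6 := pow_le_pow_right₀ (by linarith) (by norm_num)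
    exact mul_le_mul_of_nonneg_right this hε₀.le
  have hkey : 159 * (5 * (F.L : ℝ)) * (2 * 3 * (F.L : ℝ) ^ 3) / (F.L : ℝ) * ((5 * (F.L : ℝ)) ^ 2 / 16 * ε₀)
      = 159 * 5 * 6 * 25 / 16 * ((F.L : ℝ) ^ 5 * ε₀) := by
    field_simp
    ring
  rw [hkey]
  nlinarith [hL6, hε]

/-- **THE ROW CONSTANT IS `≤ 2`**: `exp(κ_∞B_c∕L) ≤ exp(1∕100) ≤ 100∕99 ≤ 2` (✓`Real.exp_bound_div_one_sub_of_interval`). [cite: Balaban1985Variational, (2) p.278] -/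
theorem row_const_le_two {ε₀ : ℝ} (hε₀ : 0 < ε₀) (hε : 10 ^ 10 * (F.L : ℝ) ^ 6 * ε₀ ≤ 1) :
    Real.exp ((159 * ((((F.P K).d + 2) * (F.P K).L : ℕ) : ℝ) * (2 * (F.P K).d * ((F.P K).L : ℝ) ^ (F.P K).d))
        / ((F.P K).L : ℝ) * (((((F.P K).d + 2) * (F.P K).L : ℕ) : ℝ) ^ 2 / 16 * ε₀)) ≤ 2 := by
  refine (Real.exp_le_exp.mpr (row_exponent_le F (K := K) hε₀ hε)).trans ?_
  refine (Real.exp_bound_div_one_sub_of_interval (by norm_num) (by norm_num)).trans ?_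
  norm_num

end Summit.QuantumFields.YangMills.Theorems.Prop7QTwSSupRows

end
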